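import Mathlib
import Summits.Ventures.PercRepro2.Defs
import Summits.Ventures.PercRepro2.Independence
import Summits.Ventures.PercRepro2.Harris
import Summits.Ventures.PercRepro2.Graph
import Summits.Ventures.PercRepro2.Exploration
import Summits.Ventures.PercRepro2.Events
import Summits.Ventures.PercRepro2.GateCylinder
import Summits.Ventures.PercRepro2.CDRequired
import Summits.Ventures.PercRepro2.CutVertexDefs
import Summits.Ventures.PercRepro2.CDCutVertex
import Summits.Ventures.PercRepro2.CDNestedInternal
import Summits.Ventures.PercRepro2.CDNestedRoutes
import Summits.Ventures.PercRepro2.CDNestedFan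
import Summits.Ventures.PercRepro2.CDNestedFanGraph
import Summits.Ventures.PercRepro2.CDNestedAC
import Summits.Ventures.PercRepro2.CDCutAC
import Summits.Ventures.PercRepro2.CDFanPocket

/-!
# Row 2′CD on a fan with arbitrary graphs hanging at ALL its vertices (blind cell PercRepro2,
mine-a g36; MINE-A.md §91.9)

`CDFanPocket.cd_of_fan_pocket` lets an arbitrary graph hang at the hub of the fan.  Here arbitrary graphs
hang at every vertex: the connection `x 0 ↔ v` (hub) is CARRIED BY THE FAN EDGES whenever every other
edge lies in a pocket hanging at a single vertex — a family of cut vertices whose near sides all contain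
`x 0` and `v`, with the intersection of the near sides inside the fan (`conn_restrict_of_cuts`:
restricting to one near side after another, `CutV.conn_iff_restrict` each time).  Under that carrying
hypothesis the route lemma `CDFanPocket.fan_route_of_conn'` applies to the fan-restricted configuration,
so every configuration with `x 0 ↔ v` opens a fan route (`ac_of_fan_carried`, through
`CDNestedAC.ac_of_nested_routes'` — any admissible weight vector), and `CDCutAC.cd_of_cut_far` puts
`a₃` anywhere beyond the hub (`cd_of_fan_pockets`): `a₂` and `o` anywhere on the near side of the hub
cut — on the fan or inside the pockets at the path vertices — `a₃` anywhere in the hub's pocket, every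
up-set, every admissible weight vector.  The intersection of the near sides is passed as a set `S` with
any decidable description (`hS`).  No definition; one seat.
-/

namespace Summit.Ventures.PercRepro2

namespace CDFanPockets

section Restrict

variable {E : Type*}

/-- Restricting twice restricts to the intersection. -/
lemma restrict_restrict (F G : Set E) [DecidablePred (· ∈ F)] [DecidablePred (· ∈ G)]
    (ω : Config E) : restrict F (restrict G ω) = restrict (F ∩ G) ω := by
  funext e
  by_cases hF : e ∈ F <;> by_cases hG : e ∈ G <;>
    simp [restrict, hF, hG]

/-- `restrict` is monotone in the edge set. -/
lemma restrict_le_restrict {F G : Set E} [DecidablePred (· ∈ F)] [DecidablePred (· ∈ G)]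
    (h : F ⊆ G) (ω : Config E) : restrict F ω ≤ restrict G ω := by
  intro e
  by_cases hF : e ∈ F
  · rw [restrict_apply_of_mem hF, restrict_apply_of_mem (h hF)]
  · rw [restrict_apply_of_notMem hF]
    exact Bool.false_le _

/-- `restrict` only depends on the edge set as a set. -/
lemma restrict_eq_of_iff {F G : Set E} [DecidablePred (· ∈ F)] [DecidablePred (· ∈ G)]
    (h : ∀ e, e ∈ F ↔ e ∈ G) (ω : Config E) : restrict F ω = restrict G ω := by
  funext e
  by_cases hF : e ∈ F
  · rw [restrict_apply_of_mem hF, restrict_apply_of_mem ((h e).1 hF)]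
  · rw [restrict_apply_of_notMem hF, restrict_apply_of_notMem (fun hG => hF ((h e).2 hG))]

/-- Restricting to every edge changes nothing. -/
lemma restrict_univ (ω : Config E) : restrict (Set.univ : Set E) ω = ω := by
  funext e
  simp [restrict]

end Restrict

section Cuts

variable {V : Type*} {E : Type*}

/-- **A connection between vertices common to the near sides of a family of cuts is carried by the
intersection of the near sides.** -/
theorem conn_restrict_of_cuts {ends : E → Sym2 V} {u w : V} (k : ℕ) (z : ℕ → V)
    (VA VB : ℕ → Set V) (EA EB : ℕ → Set E) [∀ i, DecidablePred (· ∈ EA i)]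
    (hcut : ∀ i, i < k → CutV.IsCut ends (z i) (VA i) (VB i) (EA i) (EB i))
    (hu : ∀ i, i < k → u ∈ VA i ∪ {z i}) (hw : ∀ i, i < k → w ∈ VA i ∪ {z i})
    (S : Set E) [DecidablePred (· ∈ S)] (hS : ∀ e, e ∈ S ↔ ∀ i, i < k → e ∈ EA i) (ω : Config E)
    (h : Conn ends ω u w) : Conn ends (restrict S ω) u w := by
  classical
  induction k generalizing S with
  | zero =>
    have he : restrict S ω = ω := by
      rw [restrict_eq_of_iff (G := Set.univ) (fun e => by simp [hS e]), restrict_univ]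
    rw [he]
    exact h
  | succ k ih =>
    have ih' := ih (fun i hi => hcut i (by omega)) (fun i hi => hu i (by omega))
      (fun i hi => hw i (by omega)) {e | ∀ i, i < k → e ∈ EA i} (fun _ => Iff.rfl)
    have hk := (CutV.conn_iff_restrict (hcut k (by omega))
      (ω := restrict {e | ∀ i, i < k → e ∈ EA i} ω) (hu k (by omega)) (hw k (by omega))).1 ih'
    rw [restrict_restrict] at hk
    have he : restrict (EA k ∩ {e | ∀ i, i < k → e ∈ EA i}) ω = restrict S ω := by
      refine restrict_eq_of_iff (fun e => ?_) ω
      rw [hS e]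
      simp only [Set.mem_inter_iff, Set.mem_setOf_eq]
      constructor
      · rintro ⟨hk', hlt⟩ i hi
        rcases Nat.lt_succ_iff_lt_or_eq.1 hi with hi | rfl
        · exact hlt i hi
        · exact hk'
      · intro hall
        exact ⟨hall k (Nat.lt_succ_self k), fun i hi => hall i (Nat.lt_succ_of_lt hi)⟩
    rw [he] at hk
    exact hk

end Cuts

section Theorem

variable {V : Type*} {E : Type*} [Fintype E] [DecidableEq E] [Fintype V] [DecidableEq V]
  {R : Type*} [Field R] [LinearOrder R] [IsStrictOrderedRing R]

/-- **(AC) on a fan whose connection is carried by its edges**: if the fan edges `EF` (rungs and spokes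
only) carry every connection `x 0 ↔ v`, then (AC) holds at `(x 0, a₂, v, o)` for every up-set and every
admissible weight vector — whatever the other edges are. -/
theorem ac_of_fan_carried (p : E → R) (hp : IsProbVec p) {ends : E → Sym2 V} {v : V} (a₂ o : V)
    (m : ℕ) (x : ℕ → V) (r c : ℕ → E)
    (hr : ∀ j, j < m → ends (r j) = s(x j, x (j + 1))) (hc : ∀ i, i ≤ m → ends (c i) = s(x i, v))
    (hx : ∀ i j, i ≤ m → j ≤ m → x i = x j → i = j) (hv : ∀ i, i ≤ m → x i ≠ v)
    (EF : Set E) [DecidablePred (· ∈ EF)]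
    (hEF : ∀ e : E, e ∈ EF → (∃ j, j < m ∧ e = r j) ∨ (∃ i, i ≤ m ∧ e = c i))
    (hcarry : ∀ ω : Config E, Conn ends ω (x 0) v → Conn ends (restrict EF ω) (x 0) v)
    {𝓔 : Set (Set V)} (h𝓔 : IsUpperSet 𝓔) :
    prob p ((connEvent ends (x 0) a₂)ᶜ ∩ clusterInEvent ends (x 0) 𝓔 ∩ connEvent ends (x 0) v ∩
          connEvent ends a₂ o) * prob p ((connEvent ends (x 0) a₂)ᶜ ∩ connEvent ends (x 0) v) ≤
      prob p ((connEvent ends (x 0) a₂)ᶜ ∩ clusterInEvent ends (x 0) 𝓔 ∩ connEvent ends (x 0) v) *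
        prob p ((connEvent ends (x 0) a₂)ᶜ ∩ connEvent ends (x 0) v ∩ connEvent ends a₂ o) := by
  set L : ℕ → List (E × V × V) :=
    fun i => (List.range i).map (fun j => (r j, x j, x (j + 1))) ++ [(c i, x i, v)] with hL
  have hmem : ∀ i t, t ∈ L i ↔ (∃ j < i, (r j, x j, x (j + 1)) = t) ∨ t = (c i, x i, v) := by
    intro i t
    simp [hL, List.mem_append, List.mem_map, List.mem_range]
  have hB : ∀ i, i < m + 1 →
      insert (c i) ((Finset.range i).image r) = (L i).foldl (fun acc t => insert t.1 acc) ∅ := by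
    intro i _
    ext b
    rw [CDNestedInternal.mem_foldl_insert_edges]
    simp only [Finset.mem_insert, Finset.mem_image, Finset.mem_range, Finset.notMem_empty, false_or,
      hmem]
    constructor
    · rintro (rfl | ⟨j, hj, rfl⟩)
      · exact ⟨(c i, x i, v), Or.inr rfl, rfl⟩
      · exact ⟨(r j, x j, x (j + 1)), Or.inl ⟨j, hj, rfl⟩, rfl⟩
    · rintro ⟨t, (⟨j, hj, rfl⟩ | rfl), rfl⟩
      · exact Or.inr ⟨j, hj, rfl⟩
      · exact Or.inl rfl
  have hends : ∀ i, i < m + 1 → ∀ t ∈ L i, ends t.1 = s(t.2.1, t.2.2) := by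
    intro i hi t ht
    rcases (hmem i t).1 ht with ⟨j, hj, rfl⟩ | rfl
    · exact hr j (by omega)
    · exact hc i (by omega)
  have hchain : ∀ i, List.IsChain (fun t u : E × V × V => u.2.1 = t.2.2) (L i) := by
    intro i
    rw [List.isChain_iff_getElem]
    intro j hj
    simp only [hL, List.length_append, List.length_map, List.length_range,
      List.length_singleton] at hj
    have hji : j < i := by omega
    by_cases hj1 : j + 1 < i
    · simp [hL, hji, hj1]
    · have hi : i = j + 1 := by omega
      subst hi
      simp [hL]
  have hhead : ∀ i, ∀ t ∈ (L i).head?, t.2.1 ∈ ({x 0} : Finset V) := by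
    intro i t ht
    rcases i with _ | i
    · simp only [hL, List.range_zero, List.map_nil, List.nil_append, List.head?_cons,
        Option.mem_def, Option.some.injEq] at ht
      subst ht
      simp
    · simp only [hL, List.range_succ_eq_map, List.map_cons, List.cons_append, List.head?_cons,
        Option.mem_def, Option.some.injEq] at ht
      subst ht
      simp
  have hwalk : ∀ i, i < m + 1 → ∀ j (hj : j < (L i).length), ((L i).get ⟨j, hj⟩).2.1 ∈
      ({x 0} : Finset V) ∪ (((L i).take j).map (fun u => u.2.2)).toFinset :=
    fun i _ => CDNestedFan.walk_of_isChain (L i) {x 0} (hhead i) (hchain i)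
  have h3 : ∀ i, i < m + 1 → v ∈ (L i).foldl (fun acc t => insert t.2.2 acc) ({x 0} : Finset V) := by
    intro i _
    rw [CDNestedFan.mem_foldl_insert_verts]
    exact Or.inr ⟨(c i, x i, v), (hmem i _).2 (Or.inr rfl), rfl⟩
  have hnest : ∀ l i, l < i → i < m + 1 →
      (L l).foldl (fun acc t => insert t.2.2 acc) ({x 0} : Finset V) ⊆
        (L i).foldl (fun acc t => insert t.2.2 acc) ({x 0} : Finset V) := by
    intro l i hli _ w hw
    rw [CDNestedFan.mem_foldl_insert_verts] at hw ⊢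
    rcases hw with hw | ⟨t, ht, rfl⟩
    · exact Or.inl hw
    · rcases (hmem l t).1 ht with ⟨j, hj, rfl⟩ | rfl
      · exact Or.inr ⟨(r j, x j, x (j + 1)), (hmem i _).2 (Or.inl ⟨j, by omega, rfl⟩), rfl⟩
      · exact Or.inr ⟨(c i, x i, v), (hmem i _).2 (Or.inr rfl), rfl⟩
  refine CDNestedAC.ac_of_nested_routes' p hp (m + 1) L
    (fun i => insert (c i) ((Finset.range i).image r))
    (fun i => (L i).foldl (fun acc t => insert t.2.2 acc) {x 0}) hB (fun _ _ => rfl) hends hwalk h3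
    hnest h𝓔 ?_
  intro ω _ hconn
  -- the fan-restricted configuration opens a route, hence so does `ω`
  obtain ⟨i, hi, hωi⟩ := CDFanPocket.fan_route_of_conn' hr hc hx hv
    (ω := restrict EF ω) (fun e he => hEF e (restrict_eq_true_iff.1 he).2) (hcarry ω hconn)
  refine ⟨i, hi, ?_⟩
  intro b hb
  have hle := restrict_le EF ω
  have h1 := hωi b hb
  exact Bool.eq_true_of_true_le (h1 ▸ hle b)

/-- **Row 2′CD on a fan with arbitrary graphs hanging at all its vertices.** The hub `v` is a cut vertex
(`h`) with `a₃` beyond it and `a₂, o` on its near side; a family of cut vertices `z i` (`i < k`) with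
`x 0` and `v` on their near sides (the pockets at the path vertices), such that the near side of the hub
cut meets the intersection `S` of the near sides of the family inside the fan edges `EF` (rungs and
spokes only).  Then the row
holds at `(x 0, a₂, a₃, o)` for every up-set and every admissible weight vector. -/
theorem cd_of_fan_pockets (p : E → R) (hp : IsProbVec p) {ends : E → Sym2 V} {v : V} {VA VB : Set V}
    {EA EB : Set E} [DecidablePred (· ∈ EA)] [DecidablePred (· ∈ EB)]
    (h : CutV.IsCut ends v VA VB EA EB) {a₂ a₃ o : V} (m : ℕ) (x : ℕ → V) (r c : ℕ → E)
    (hr : ∀ j, j < m → ends (r j) = s(x j, x (j + 1))) (hc : ∀ i, i ≤ m → ends (c i) = s(x i, v))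
    (hx : ∀ i j, i ≤ m → j ≤ m → x i = x j → i = j) (hv : ∀ i, i ≤ m → x i ≠ v)
    (hx0 : x 0 ∈ VA ∪ {v}) (ha₂ : a₂ ∈ VA ∪ {v}) (ho : o ∈ VA ∪ {v}) (ha₃ : a₃ ∈ VB)
    (EF : Set E) [DecidablePred (· ∈ EF)]
    (hEF : ∀ e : E, e ∈ EF → (∃ j, j < m ∧ e = r j) ∨ (∃ i, i ≤ m ∧ e = c i))
    (k : ℕ) (z : ℕ → V) (VA' VB' : ℕ → Set V) (EA' EB' : ℕ → Set E)
    [∀ i, DecidablePred (· ∈ EA' i)]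
    (hcut : ∀ i, i < k → CutV.IsCut ends (z i) (VA' i) (VB' i) (EA' i) (EB' i))
    (hx0' : ∀ i, i < k → x 0 ∈ VA' i ∪ {z i}) (hv' : ∀ i, i < k → v ∈ VA' i ∪ {z i})
    (S : Set E) [DecidablePred (· ∈ S)] (hS : ∀ e, e ∈ S ↔ ∀ i, i < k → e ∈ EA' i)
    (hsub : S ∩ EA ⊆ EF)
    {𝓔 : Set (Set V)} (h𝓔 : IsUpperSet 𝓔) :
    let Q := (connEvent ends (x 0) a₂)ᶜ
    let U := clusterInEvent ends (x 0) 𝓔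
    let e := connEvent ends (x 0) a₃
    let f := connEvent ends a₂ o
    let N := (connEvent ends (x 0) a₃)ᶜ ∩ (connEvent ends a₂ a₃)ᶜ
    let oU := connEvent ends (x 0) o ∪ connEvent ends a₂ o
    prob p (Q ∩ N) * (prob p Q * prob p (Q ∩ U ∩ e ∩ f) - prob p (Q ∩ U) * prob p (Q ∩ e ∩ f)) ≤
      prob p (Q ∩ N ∩ oU) * (prob p Q * prob p (Q ∩ U ∩ e) - prob p (Q ∩ U) * prob p (Q ∩ e)) := by
  -- the fan carries the connection `x 0 ↔ v`
  have hcarry : ∀ ω : Config E, Conn ends ω (x 0) v → Conn ends (restrict EF ω) (x 0) v := by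
    intro ω hω
    have h1 : Conn ends (restrict EA ω) (x 0) v := (CutV.conn_iff_restrict h hx0 (Or.inr rfl)).1 hω
    have h2 := conn_restrict_of_cuts k z VA' VB' EA' EB' hcut hx0' hv' S hS (restrict EA ω) h1
    rw [restrict_restrict] at h2
    exact conn_mono (restrict_le_restrict hsub ω) h2
  exact CDCutAC.cd_of_cut_far p hp h hx0 ha₂ ho ha₃ h𝓔 fun _ h𝓤 =>
    ac_of_fan_carried _ (CDCutVertex.isProbVec_zeroOff hp EA) a₂ o m x r c hr hc hx hv EF hEF hcarry
      h𝓤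

end Theorem

end CDFanPockets

end Summit.Ventures.PercRepro2
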